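import Summits.PneNP.PneNP.Theorems.ChebyshevTracialDesignVirtualLayerRatio
import Summits.PneNP.PneNP.Theorems.ChebyshevTracialDesignTightLayerBimode
import HarnessLib

/-!
# Cell pnp-psdrank, route `ChebyshevTracialDesign`: the VIRTUAL VALUE in bi-mode form — Grigoriev's averaged pseudo-expectation of the
# low part is the sum of the TIGHT layer correlations, re-weighted layer by layer by `R_κ = 1 + ρ_{2κ}`

Harmonic backbone of the crux `TracialDecayExp20` (stmt-PneNP-19878), brick 45 (prover g10; second input of NTF mod KL, MEMO-12 §3 (0)).
By the r = 1 degree-truncation theorem (brick 19 `…ProfileExtrapolation.rectangle_value_truncation_explicit`) the design value of a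
(weighted) rectangle is MINUS its VIRTUAL VALUE `Virt = (1/|PM|)·Σ_M y(M)·Ẽ_M[f_{≤D}]` up to the explicit tail `B√(P_D μν)`. This file
expresses `Virt` through the tight layer correlations `T_{2κ}(p, y) = Σ_M y(M) Σ_{|U|=t} ((Wᵀ)^{t−2κ}p_{2κ})(U)·1[cc(U,M) = 1]` of SNT
(bricks 25–28) and the layer ratio `R_κ` of brick 44 (`…VirtualLayerRatio`):
* §1 `virtualSum_lowPart_mul_eq` — per matching: `Ẽ_M[f_{≤D}] · N₁ = Σ_{κ ≤ D/2} R_κ · Σ_{|U|=t} ((Wᵀ)^{t−2κ}p_{2κ})(U)·1[cc(U,M) = 1]`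
  (odd layers invisible on both sides; even layers by `virtualSum_mul_eq_ratio_mul_tightSum`);
* §2 **`virtual_weighted_mul_eq`** — for any weights `y`: `(Σ_M y(M)·Ẽ_M[f_{≤D}])·N₁ = Σ_{κ ≤ D/2} R_κ·T_{2κ}(p, y)`, and for a 0/1 rectangle
  `X × Y` (`virtual_rectangle_eq`): `(1/|PM|)·Σ_{M∈Y} Ẽ_M[(1_X)_{≤D}] = μ(X)ν(Y) + Σ_{1 ≤ κ ≤ D/2} R_κ·T_{2κ}(X,Y)/(|PM|·N₁)`;
* §3 **`virtual_rectangle_ge`** — hence `Virt(X × Y) ≥ μν − Σ_{1≤κ≤D/2} 2^κ·|T_{2κ}(X,Y)|/(|PM|·N₁)` (`R_κ ≤ 2^κ`), and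
  **`rectangle_value_le_tail_of_layerBounds`**: for an exact design of degree `D` with `Σ|w_c| ≤ B`, if `|T_{2κ}|/(|PM|N₁) ≤ 4μν·16^{−κ}`
  for `1 ≤ κ ≤ D/2` (SNT's head estimate) then `Virt ≥ (3/7)μν` and the design value satisfies `V(X × Y) ≤ B·√(P_D μν)` — NO tight-freeness.
So MEMO-12 §2(d)'s mode budget is a kernel identity: `Virt = μν + Σ_κ (1+ρ_{2κ}) c_κ` with `c_κ = T_{2κ}/(|PM|N₁)` the tight modes; for a
tight-free rectangle `Σ_{κ≥1} c_κ = −μν` (brick 27), so `Virt = Σ_{κ≤D/2} ρ_{2κ} c_κ − Σ_{κ>D/2} c_κ`.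
[cite: Grigoriev2001, Lemma 1.4 (PDF p. 8)] [cite: Rothvoss2017, §2 (PDF p. 6)] [cite: BrouwerHaemers2012, Prop. 4.3.2 (PDF p. 83)]
Stature: support/instrument (no defs). WHAT THIS IS NOT: not virtual nonnegativity for spread cells (that needs the KL head estimate, next file),
nothing on psd rank, no P-vs-NP content. Supports stmt-PneNP-19878.
-/

set_option linter.dupNamespace false -- `Summit.PneNP.PneNP.…`: summit = sub-problem (D-0017)

noncomputable section

namespace Summit.PneNP.PneNP.Theorems.ChebyshevTracialDesignVirtualBimode

open Finset Literature.Barriers.PneNP Literature.Computability.Complexity Literature.Combinatorics.Optimization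
open Literature.Combinatorics.SimpleGraph.CycleSpace
open Literature.Combinatorics.AssociationSchemes Literature.Combinatorics.AssociationSchemes.JohnsonHarmonics
open Literature.Combinatorics.AssociationSchemes.JohnsonSpectrum
open Summit.PneNP.PneNP.Theorems.ChebyshevTracialDesignTightColumnSums
open Summit.PneNP.PneNP.Theorems.ChebyshevTracialDesignTightLayerBimode
open Summit.PneNP.PneNP.Theorems.ChebyshevTracialDesignTightFreeLayers
open Summit.PneNP.PneNP.Theorems.ChebyshevTracialDesignProfileExtrapolation
open Summit.PneNP.PneNP.Theorems.ChebyshevTracialDesignProfilePolynomial (card_pmatch_pos)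
open Summit.PneNP.PneNP.Theorems.ChebyshevTracialDesignLevelTail (prod_atten_le_of_le atten_factor_le_one)
open Summit.PneNP.PneNP.Theorems.ChebyshevTracialDesignVirtualLayerFunctional
open Summit.PneNP.PneNP.Theorems.ChebyshevTracialDesignVirtualLayerRatio

variable {n : ℕ}

/-! ### §1 Per matching: the virtual value of the low part through the tight column sums -/

/-- A sum over the subtype `{A // |A| ≤ D}` of a function vanishing beyond size `D` is the full sum. [folklore] -/
theorem sum_subtype_card_le_eq {D : ℕ} (g : Finset (Fin n) → ℝ) (hg : ∀ A : Finset (Fin n), D < A.card → g A = 0) :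
    ∑ A : {A : Finset (Fin n) // A.card ≤ D}, g A.1 = ∑ A : Finset (Fin n), g A := by
  classical
  rw [← sum_subtype (univ.filter fun A : Finset (Fin n) => A.card ≤ D) (fun A => by simp) g]
  rw [sum_filter]
  refine sum_congr rfl fun A _ => ?_
  split_ifs with h
  · rfl
  · exact (hg A (not_le.1 h)).symm

/-- **One layer of the low part, per matching**: for `j ≤ t = 2c'+1` (`2t ≤ n`, `j ≤ 2c'`, `2j ≤ n`) and a harmonic `p_j`,
`(t−j)!·(Σ_A p_j(A)·knapsackMoment(|M|, t/2, x_M(A)))·N₁` is `0` for odd `j` and `R_{j/2}·Σ_{|U|=t} ((Wᵀ)^{t−j}p_j)(U)·1[#cr(U,M)=1]`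
for even `j`. [cite: Grigoriev2001, Lemma 1.4 (PDF p. 8)] [cite: Rothvoss2017, §2 (PDF p. 6)] -/
theorem layer_virtual_mul_eq {c' j : ℕ} (hn : Even n) (ht : 2 * (2 * c' + 1) ≤ n) (hj : j ≤ 2 * c') (hjn : 2 * j ≤ n)
    {pj : Finset (Fin n) → ℝ} (hp : IsHarmonic j pj) (M : PMatch n) :
    ((2 * c' + 1 - j).factorial : ℝ) *
        (∑ A : Finset (Fin n), pj A *
          knapsackMoment M.1.card (((2 * c' + 1 : ℕ) : ℝ) / 2) (M.1.filter fun e => ∃ a ∈ A, a ∈ e).card) *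
        ((((n / 2).choose (1 + c') * (1 + c').choose c' * 2 ^ 1 : ℕ) : ℝ)) =
      if Odd j then 0 else
        (∏ i ∈ range (j / 2), (((2 * c' + 1 : ℝ) - 2 * i) * ((n : ℝ) - 2 * c' - 1 - 2 * i) /
            (((2 * c' : ℝ) - 2 * i) * ((n : ℝ) - 2 * c' - 2 - 2 * i)))) *
          ∑ U ∈ univ.powersetCard (2 * c' + 1),
            (up^[2 * c' + 1 - j] pj) U * (if (U.filter fun x => M.2.partner x ∉ U).card = 1 then (1 : ℝ) else 0) := by
  rcases Nat.even_or_odd j with ⟨κ, hκ⟩ | ho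
  · have hjκ : j = 2 * κ := by omega
    subst hjκ
    rw [if_neg (by rw [Nat.not_odd_iff_even]; exact ⟨κ, by ring⟩), show 2 * κ / 2 = κ by omega,
      col_ladder_eq_factorial_mul_tightSum ⟨c', rfl⟩ (by omega) M hp, mul_assoc,
      virtualSum_mul_eq_ratio_mul_tightSum hn ht (by omega) (by omega) M hp]
    ring
  · rw [if_pos ho, virtualSum_eq_zero_of_odd M ho hp]
    simp

/-- **Per matching: `Ẽ_M[f_{≤D}]·N₁ = Σ_{κ≤D/2} R_κ · (tight column sum of layer 2κ)`.** For `n` even, `t = 2c'+1`, `2t ≤ n`, `D ≤ 2c'`,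
harmonic layers `p_j` and `q = Σ_j (t−j)!·[j ≤ D]·p_j` the coefficient vector of the low part, every perfect matching `M` satisfies
`(Σ_{|A|≤D} q_A·knapsackMoment(|M|, t/2, x_M(A)))·N₁ = Σ_{κ ≤ D/2} R_κ · Σ_{|U|=t} ((Wᵀ)^{t−2κ}p_{2κ})(U)·1[#cr(U,M) = 1]`.
[cite: Grigoriev2001, Lemma 1.4 (PDF p. 8)] [cite: Rothvoss2017, §2 (PDF p. 6)] -/
theorem virtualSum_lowPart_mul_eq {c' D : ℕ} (hn : Even n) (ht : 2 * (2 * c' + 1) ≤ n) (hD : D ≤ 2 * c')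
    (p : ℕ → Finset (Fin n) → ℝ) (hp : ∀ j, IsHarmonic j (p j)) (M : PMatch n) :
    (∑ A : {A : Finset (Fin n) // A.card ≤ D},
        (∑ j ∈ range (2 * c' + 1 + 1), ((2 * c' + 1 - j).factorial : ℝ) • (if D < j then 0 else p j)) A.1 *
          knapsackMoment M.1.card (((2 * c' + 1 : ℕ) : ℝ) / 2) (M.1.filter fun e => ∃ a ∈ A.1, a ∈ e).card) *
        ((((n / 2).choose (1 + c') * (1 + c').choose c' * 2 ^ 1 : ℕ) : ℝ)) =
      ∑ κ ∈ range (D / 2 + 1),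
        (∏ i ∈ range κ, (((2 * c' + 1 : ℝ) - 2 * i) * ((n : ℝ) - 2 * c' - 1 - 2 * i) /
            (((2 * c' : ℝ) - 2 * i) * ((n : ℝ) - 2 * c' - 2 - 2 * i)))) *
          ∑ U ∈ univ.powersetCard (2 * c' + 1),
            (up^[2 * c' + 1 - 2 * κ] (p (2 * κ))) U * (if (U.filter fun x => M.2.partner x ∉ U).card = 1 then (1 : ℝ) else 0) := by
  classical
  set N1 : ℝ := ((((n / 2).choose (1 + c') * (1 + c').choose c' * 2 ^ 1 : ℕ) : ℝ)) with hN1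
  set q : Finset (Fin n) → ℝ :=
    ∑ j ∈ range (2 * c' + 1 + 1), ((2 * c' + 1 - j).factorial : ℝ) • (if D < j then 0 else p j) with hq
  obtain ⟨U₀, hU₀⟩ : ∃ U : Finset (Fin n), U ∈ univ.powersetCard (2 * c' + 1) := by
    have : (univ.powersetCard (2 * c' + 1) : Finset (Finset (Fin n))).Nonempty := by
      apply powersetCard_nonempty.2; rw [card_univ, Fintype.card_fin]; omega
    exact this
  have hq0 : ∀ A : Finset (Fin n), D < A.card → q A = 0 :=
    fun A hA => (lowPart_apply_eq_zeta D p hp (mem_powersetCard.1 hU₀).2).2 A hA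
  -- pass to the full sum and expand `q`
  rw [sum_subtype_card_le_eq (fun A => q A *
      knapsackMoment M.1.card (((2 * c' + 1 : ℕ) : ℝ) / 2) (M.1.filter fun e => ∃ a ∈ A, a ∈ e).card)
    (fun A hA => by rw [hq0 A hA, zero_mul])]
  have hqA : ∀ A : Finset (Fin n), q A =
      ∑ j ∈ range (2 * c' + 1 + 1), ((2 * c' + 1 - j).factorial : ℝ) * (if D < j then 0 else p j A) := by
    intro A
    simp only [hq, Finset.sum_apply, Pi.smul_apply, smul_eq_mul]
    refine sum_congr rfl fun j _ => ?_
    split_ifs <;> simp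
  simp_rw [hqA, sum_mul]
  rw [sum_comm]
  -- the summand of layer `j`: only the even `j ≤ D` survive
  have hlayer : ∀ j ∈ range (2 * c' + 1 + 1),
      ∑ A : Finset (Fin n), ((2 * c' + 1 - j).factorial : ℝ) * (if D < j then 0 else p j A) *
          knapsackMoment M.1.card (((2 * c' + 1 : ℕ) : ℝ) / 2) (M.1.filter fun e => ∃ a ∈ A, a ∈ e).card * N1 =
        if D < j ∨ Odd j then 0 else
          (∏ i ∈ range (j / 2), (((2 * c' + 1 : ℝ) - 2 * i) * ((n : ℝ) - 2 * c' - 1 - 2 * i) /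
              (((2 * c' : ℝ) - 2 * i) * ((n : ℝ) - 2 * c' - 2 - 2 * i)))) *
            ∑ U ∈ univ.powersetCard (2 * c' + 1),
              (up^[2 * c' + 1 - j] (p j)) U * (if (U.filter fun x => M.2.partner x ∉ U).card = 1 then (1 : ℝ) else 0) := by
    intro j hj
    by_cases hDj : D < j
    · rw [if_pos (Or.inl hDj)]
      refine sum_eq_zero fun A _ => ?_
      rw [if_pos hDj]; ring
    · have hjD : j ≤ D := not_lt.1 hDj
      have hite : ∀ A : Finset (Fin n), (if D < j then (0 : ℝ) else p j A) = p j A := fun A => if_neg hDj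
      simp_rw [hite]
      rw [show (if D < j ∨ Odd j then (0 : ℝ) else
          (∏ i ∈ range (j / 2), (((2 * c' + 1 : ℝ) - 2 * i) * ((n : ℝ) - 2 * c' - 1 - 2 * i) /
              (((2 * c' : ℝ) - 2 * i) * ((n : ℝ) - 2 * c' - 2 - 2 * i)))) *
            ∑ U ∈ univ.powersetCard (2 * c' + 1),
              (up^[2 * c' + 1 - j] (p j)) U * (if (U.filter fun x => M.2.partner x ∉ U).card = 1 then (1 : ℝ) else 0)) =
          (if Odd j then (0 : ℝ) else
          (∏ i ∈ range (j / 2), (((2 * c' + 1 : ℝ) - 2 * i) * ((n : ℝ) - 2 * c' - 1 - 2 * i) /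
              (((2 * c' : ℝ) - 2 * i) * ((n : ℝ) - 2 * c' - 2 - 2 * i)))) *
            ∑ U ∈ univ.powersetCard (2 * c' + 1),
              (up^[2 * c' + 1 - j] (p j)) U * (if (U.filter fun x => M.2.partner x ∉ U).card = 1 then (1 : ℝ) else 0)) by
          simp only [hDj, false_or],
        ← layer_virtual_mul_eq hn ht (by omega) (by omega) (hp j) M, mul_sum, sum_mul]
      exact sum_congr rfl fun A _ => by ring
  rw [sum_congr rfl hlayer]
  -- reindex `j = 2κ`
  symm
  refine sum_of_injOn (fun κ => 2 * κ) (fun a _ b _ h => by simpa using h) ?_ ?_ ?_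
  · intro κ hκ
    simp only [coe_range, Set.mem_Iio] at hκ ⊢
    omega
  · intro j hj hnot
    simp only [Set.mem_image, coe_range, Set.mem_Iio, not_exists, not_and] at hnot
    rw [if_pos]
    by_cases hDj : D < j
    · exact Or.inl hDj
    · right
      rcases Nat.even_or_odd j with ⟨κ, hκ⟩ | ho
      · exact absurd hκ (by intro h; exact hnot κ (by omega) (by omega))
      · exact ho
  · intro κ hκ
    have hκD : 2 * κ ≤ D := by have := mem_range.1 hκ; omega
    rw [if_neg (by push Not; exact ⟨by omega, by rw [Nat.not_odd_iff_even]; exact ⟨κ, by ring⟩⟩),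
      show 2 * κ / 2 = κ by omega]

/-! ### §2 Weighted rectangles and 0/1 rectangles -/

/-- **The virtual value through the tight layer correlations (weighted form).** For `n` even, `t = 2c'+1`, `2t ≤ n`, `D ≤ 2c'`,
harmonic layers `p_j` (of a test function `f = Σ_j (Wᵀ)^{t−j}p_j` on the `t`-cuts) and ANY weights `y` on the perfect matchings:
`(Σ_M y(M)·Ẽ_M[f_{≤D}])·N₁ = Σ_{κ≤D/2} R_κ · T_{2κ}(p, y)`, `T_{2κ}(p,y) = Σ_M y(M)·Σ_{|U|=t} ((Wᵀ)^{t−2κ}p_{2κ})(U)·1[#cr(U,M)=1]`.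
[cite: Grigoriev2001, Lemma 1.4 (PDF p. 8)] [cite: Rothvoss2017, §2 (PDF p. 6)] -/
theorem virtual_weighted_mul_eq {c' D : ℕ} (hn : Even n) (ht : 2 * (2 * c' + 1) ≤ n) (hD : D ≤ 2 * c')
    (p : ℕ → Finset (Fin n) → ℝ) (hp : ∀ j, IsHarmonic j (p j)) (y : PMatch n → ℝ) :
    (∑ M : PMatch n, y M * ∑ A : {A : Finset (Fin n) // A.card ≤ D},
        (∑ j ∈ range (2 * c' + 1 + 1), ((2 * c' + 1 - j).factorial : ℝ) • (if D < j then 0 else p j)) A.1 *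
          knapsackMoment M.1.card (((2 * c' + 1 : ℕ) : ℝ) / 2) (M.1.filter fun e => ∃ a ∈ A.1, a ∈ e).card) *
        ((((n / 2).choose (1 + c') * (1 + c').choose c' * 2 ^ 1 : ℕ) : ℝ)) =
      ∑ κ ∈ range (D / 2 + 1),
        (∏ i ∈ range κ, (((2 * c' + 1 : ℝ) - 2 * i) * ((n : ℝ) - 2 * c' - 1 - 2 * i) /
            (((2 * c' : ℝ) - 2 * i) * ((n : ℝ) - 2 * c' - 2 - 2 * i)))) *
          ∑ M : PMatch n, y M * ∑ U ∈ univ.powersetCard (2 * c' + 1),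
            (up^[2 * c' + 1 - 2 * κ] (p (2 * κ))) U * (if (U.filter fun x => M.2.partner x ∉ U).card = 1 then (1 : ℝ) else 0) := by
  rw [sum_mul]
  have hM : ∀ M : PMatch n, y M * (∑ A : {A : Finset (Fin n) // A.card ≤ D},
        (∑ j ∈ range (2 * c' + 1 + 1), ((2 * c' + 1 - j).factorial : ℝ) • (if D < j then 0 else p j)) A.1 *
          knapsackMoment M.1.card (((2 * c' + 1 : ℕ) : ℝ) / 2) (M.1.filter fun e => ∃ a ∈ A.1, a ∈ e).card) *
        ((((n / 2).choose (1 + c') * (1 + c').choose c' * 2 ^ 1 : ℕ) : ℝ)) =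
      y M * ∑ κ ∈ range (D / 2 + 1),
        (∏ i ∈ range κ, (((2 * c' + 1 : ℝ) - 2 * i) * ((n : ℝ) - 2 * c' - 1 - 2 * i) /
            (((2 * c' : ℝ) - 2 * i) * ((n : ℝ) - 2 * c' - 2 - 2 * i)))) *
          ∑ U ∈ univ.powersetCard (2 * c' + 1),
            (up^[2 * c' + 1 - 2 * κ] (p (2 * κ))) U * (if (U.filter fun x => M.2.partner x ∉ U).card = 1 then (1 : ℝ) else 0) := by
    intro M
    rw [mul_assoc, virtualSum_lowPart_mul_eq hn ht hD p hp M]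
  rw [sum_congr rfl fun M _ => hM M]
  simp_rw [mul_sum]
  rw [sum_comm]
  exact sum_congr rfl fun κ _ => sum_congr rfl fun M _ => sum_congr rfl fun U _ => by ring

/-- **The virtual value of a 0/1 rectangle in bi-mode form.** For `n` even, `t = 2c'+1`, `2t ≤ n`, `D ≤ 2c'`, a family `X` of `t`-subsets with
harmonic layer decomposition `p` of its indicator and a set `Y` of perfect matchings:
`(1/|PM|)·Σ_{M∈Y} Ẽ_M[(1_X)_{≤D}] = μ(X)ν(Y) + Σ_{1≤κ≤D/2} R_κ · T_{2κ}(X,Y)/(|PM|·N₁)`.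
[cite: Grigoriev2001, Lemma 1.4 (PDF p. 8)] [cite: Rothvoss2017, §2 (PDF p. 6)] -/
theorem virtual_rectangle_eq {c' D : ℕ} (hn : Even n) (ht : 2 * (2 * c' + 1) ≤ n) (hD : D ≤ 2 * c')
    (X : Finset (Finset (Fin n))) (hX : X ⊆ univ.powersetCard (2 * c' + 1)) (Y : Finset (PMatch n))
    (p : ℕ → Finset (Fin n) → ℝ) (hp : ∀ j, IsHarmonic j (p j))
    (hdec : ∀ U ∈ univ.powersetCard (2 * c' + 1),
      (if U ∈ X then (1 : ℝ) else 0) = (∑ j ∈ range (2 * c' + 1 + 1), up^[2 * c' + 1 - j] (p j)) U) :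
    (Fintype.card (PMatch n) : ℝ)⁻¹ * ∑ M ∈ Y, ∑ A : {A : Finset (Fin n) // A.card ≤ D},
        (∑ j ∈ range (2 * c' + 1 + 1), ((2 * c' + 1 - j).factorial : ℝ) • (if D < j then 0 else p j)) A.1 *
          knapsackMoment M.1.card (((2 * c' + 1 : ℕ) : ℝ) / 2) (M.1.filter fun e => ∃ a ∈ A.1, a ∈ e).card =
      ((X.card : ℝ) / (n.choose (2 * c' + 1) : ℝ)) * ((Y.card : ℝ) / (Fintype.card (PMatch n) : ℝ)) +
        ∑ κ ∈ Icc 1 (D / 2),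
          (∏ i ∈ range κ, (((2 * c' + 1 : ℝ) - 2 * i) * ((n : ℝ) - 2 * c' - 1 - 2 * i) /
              (((2 * c' : ℝ) - 2 * i) * ((n : ℝ) - 2 * c' - 2 - 2 * i)))) *
            ((∑ M ∈ Y, ∑ U ∈ univ.powersetCard (2 * c' + 1),
                (up^[2 * c' + 1 - 2 * κ] (p (2 * κ))) U * (if (U.filter fun x => M.2.partner x ∉ U).card = 1 then (1 : ℝ) else 0)) /
              ((Fintype.card (PMatch n) : ℝ) * ((((n / 2).choose (1 + c') * (1 + c').choose c' * 2 ^ 1 : ℕ) : ℝ)))) := by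
  classical
  have hPMpos : (0 : ℝ) < (Fintype.card (PMatch n) : ℝ) := by exact_mod_cast card_pmatch_pos hn
  have hN1pos : (0 : ℝ) < ((((n / 2).choose (1 + c') * (1 + c').choose c' * 2 ^ 1 : ℕ) : ℝ)) := by
    have h1 : 0 < (n / 2).choose (1 + c') := Nat.choose_pos (by omega)
    have h2 : 0 < (1 + c').choose c' := Nat.choose_pos (by omega)
    positivity
  -- weighted form with `y = 1_Y`
  have hw := virtual_weighted_mul_eq hn ht hD p hp (fun M => if M ∈ Y then (1 : ℝ) else 0)
  rw [sum_boole_mul_univ Y] at hw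
  have hT : ∀ κ, ∑ M : PMatch n, (if M ∈ Y then (1 : ℝ) else 0) * ∑ U ∈ univ.powersetCard (2 * c' + 1),
      (up^[2 * c' + 1 - 2 * κ] (p (2 * κ))) U * (if (U.filter fun x => M.2.partner x ∉ U).card = 1 then (1 : ℝ) else 0) =
      ∑ M ∈ Y, ∑ U ∈ univ.powersetCard (2 * c' + 1),
      (up^[2 * c' + 1 - 2 * κ] (p (2 * κ))) U * (if (U.filter fun x => M.2.partner x ∉ U).card = 1 then (1 : ℝ) else 0) :=
    fun κ => sum_boole_mul_univ Y _
  simp_rw [hT] at hw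
  -- split off `κ = 0`
  have hsplit : range (D / 2 + 1) = insert 0 (Icc 1 (D / 2)) := by
    ext κ; simp only [mem_range, mem_insert, mem_Icc]; omega
  rw [hsplit, sum_insert (by simp), prod_range_zero, one_mul, Nat.mul_zero,
    layerCorr_zero_eq (by omega) X hX Y p hp hdec] at hw
  -- divide by `|PM| · N₁`
  set V := ∑ M ∈ Y, ∑ A : {A : Finset (Fin n) // A.card ≤ D},
        (∑ j ∈ range (2 * c' + 1 + 1), ((2 * c' + 1 - j).factorial : ℝ) • (if D < j then 0 else p j)) A.1 *
          knapsackMoment M.1.card (((2 * c' + 1 : ℕ) : ℝ) / 2) (M.1.filter fun e => ∃ a ∈ A.1, a ∈ e).card with hV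
  have hVeq : (Fintype.card (PMatch n) : ℝ)⁻¹ * V =
      (V * ((((n / 2).choose (1 + c') * (1 + c').choose c' * 2 ^ 1 : ℕ) : ℝ))) /
        ((Fintype.card (PMatch n) : ℝ) * ((((n / 2).choose (1 + c') * (1 + c').choose c' * 2 ^ 1 : ℕ) : ℝ))) := by
    field_simp
  rw [hVeq, hw, add_div, sum_div]
  congr 1
  · field_simp
  · refine sum_congr rfl fun κ _ => ?_
    rw [mul_div_assoc]

/-! ### §3 A lower bound for the virtual value from bounds on the tight layer correlations -/

/-- **`Virt(X × Y) ≥ μν − Σ_{1≤κ≤D/2} 2^κ·|T_{2κ}|/(|PM|N₁)`** (`D + 2 ≤ 2c'`, so that `R_κ ≤ 2^κ` for `κ ≤ D/2`).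
[cite: Grigoriev2001, Lemma 1.4 (PDF p. 8)] [cite: Rothvoss2017, §2 (PDF p. 6)] -/
theorem virtual_rectangle_ge {c' D : ℕ} (hn : Even n) (ht : 2 * (2 * c' + 1) ≤ n) (hD : D + 2 ≤ 2 * c')
    (X : Finset (Finset (Fin n))) (hX : X ⊆ univ.powersetCard (2 * c' + 1)) (Y : Finset (PMatch n))
    (p : ℕ → Finset (Fin n) → ℝ) (hp : ∀ j, IsHarmonic j (p j))
    (hdec : ∀ U ∈ univ.powersetCard (2 * c' + 1),
      (if U ∈ X then (1 : ℝ) else 0) = (∑ j ∈ range (2 * c' + 1 + 1), up^[2 * c' + 1 - j] (p j)) U) :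
    ((X.card : ℝ) / (n.choose (2 * c' + 1) : ℝ)) * ((Y.card : ℝ) / (Fintype.card (PMatch n) : ℝ)) -
        ∑ κ ∈ Icc 1 (D / 2), (2 : ℝ) ^ κ *
          (|∑ M ∈ Y, ∑ U ∈ univ.powersetCard (2 * c' + 1),
              (up^[2 * c' + 1 - 2 * κ] (p (2 * κ))) U * (if (U.filter fun x => M.2.partner x ∉ U).card = 1 then (1 : ℝ) else 0)| /
            ((Fintype.card (PMatch n) : ℝ) * ((((n / 2).choose (1 + c') * (1 + c').choose c' * 2 ^ 1 : ℕ) : ℝ)))) ≤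
      (Fintype.card (PMatch n) : ℝ)⁻¹ * ∑ M ∈ Y, ∑ A : {A : Finset (Fin n) // A.card ≤ D},
        (∑ j ∈ range (2 * c' + 1 + 1), ((2 * c' + 1 - j).factorial : ℝ) • (if D < j then 0 else p j)) A.1 *
          knapsackMoment M.1.card (((2 * c' + 1 : ℕ) : ℝ) / 2) (M.1.filter fun e => ∃ a ∈ A.1, a ∈ e).card := by
  rw [virtual_rectangle_eq hn ht (by omega) X hX Y p hp hdec, sub_eq_add_neg, ← sum_neg_distrib, add_le_add_iff_left]
  apply sum_le_sum
  intro κ hκ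
  obtain ⟨hκ1, hκD⟩ := mem_Icc.1 hκ
  have hpos : (0 : ℝ) < (Fintype.card (PMatch n) : ℝ) * ((((n / 2).choose (1 + c') * (1 + c').choose c' * 2 ^ 1 : ℕ) : ℝ)) := by
    have h1 : 0 < (n / 2).choose (1 + c') := Nat.choose_pos (by omega)
    have h2 : 0 < (1 + c').choose c' := Nat.choose_pos (by omega)
    have h3 := card_pmatch_pos hn
    positivity
  have hR0 : 0 ≤ ∏ i ∈ range κ, (((2 * c' + 1 : ℝ) - 2 * i) * ((n : ℝ) - 2 * c' - 1 - 2 * i) /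
      (((2 * c' : ℝ) - 2 * i) * ((n : ℝ) - 2 * c' - 2 - 2 * i))) :=
    zero_le_one.trans (one_le_layerRatio (n := n) (a := c') ht (by omega))
  have hR2 := layerRatio_le_two_pow (n := n) (a := c') (κ := κ) ht (by omega)
  set T := ∑ M ∈ Y, ∑ U ∈ univ.powersetCard (2 * c' + 1),
    (up^[2 * c' + 1 - 2 * κ] (p (2 * κ))) U * (if (U.filter fun x => M.2.partner x ∉ U).card = 1 then (1 : ℝ) else 0) with hTdef
  -- `−2^κ |T|/(PM N1) ≤ R_κ T/(PM N1)`
  have h1 : -|T| / ((Fintype.card (PMatch n) : ℝ) * ((((n / 2).choose (1 + c') * (1 + c').choose c' * 2 ^ 1 : ℕ) : ℝ))) ≤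
      T / ((Fintype.card (PMatch n) : ℝ) * ((((n / 2).choose (1 + c') * (1 + c').choose c' * 2 ^ 1 : ℕ) : ℝ))) :=
    div_le_div_of_nonneg_right (neg_abs_le T) hpos.le
  have habs : |(∏ i ∈ range κ, (((2 * c' + 1 : ℝ) - 2 * i) * ((n : ℝ) - 2 * c' - 1 - 2 * i) /
      (((2 * c' : ℝ) - 2 * i) * ((n : ℝ) - 2 * c' - 2 - 2 * i)))) *
      (T / ((Fintype.card (PMatch n) : ℝ) * ((((n / 2).choose (1 + c') * (1 + c').choose c' * 2 ^ 1 : ℕ) : ℝ))))| ≤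
      (2 : ℝ) ^ κ * (|T| / ((Fintype.card (PMatch n) : ℝ) * ((((n / 2).choose (1 + c') * (1 + c').choose c' * 2 ^ 1 : ℕ) : ℝ)))) := by
    rw [abs_mul, abs_of_nonneg hR0, abs_div, abs_of_pos hpos]
    exact mul_le_mul_of_nonneg_right hR2 (by positivity)
  have := neg_abs_le ((∏ i ∈ range κ, (((2 * c' + 1 : ℝ) - 2 * i) * ((n : ℝ) - 2 * c' - 1 - 2 * i) /
      (((2 * c' : ℝ) - 2 * i) * ((n : ℝ) - 2 * c' - 2 - 2 * i)))) *
      (T / ((Fintype.card (PMatch n) : ℝ) * ((((n / 2).choose (1 + c') * (1 + c').choose c' * 2 ^ 1 : ℕ) : ℝ)))))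
  linarith

/-- **Design value of a rectangle with small tight layer correlations, NO tight-freeness.** For `n` even and an exact design
`(n, t = 2c'+1, T, D, B, C, w)` with `D + 2 ≤ 2c'`, a family `X` of `t`-subsets (harmonic layers `p` of `1_X`) and a set `Y` of perfect
matchings whose tight layer correlations obey SNT's head estimate `|T_{2κ}(X,Y)|/(|PM|·N₁) ≤ 4μν·16^{−κ}` for `1 ≤ κ ≤ D/2`: the virtual value is
`≥ (3/7)μν ≥ 0`, hence `Σ_{U : U.1 ∈ X} Σ_{M∈Y} W(U,M) ≤ B·√(P_D·μ·ν)` (brick 19's truncation theorem). [cite: Rothvoss2017, §2 (PDF p. 6)]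
[cite: Grigoriev2001, Lemma 1.4 (PDF p. 8)] [cite: KeevashLifshitz2023, Thm. 1.8] -/
theorem rectangle_value_le_tail_of_layerBounds {c' T D : ℕ} {Bv : ℝ} {C : Finset ℕ} {w : ℕ → ℝ} (hn : Even n)
    (hdes : IsExactDesign n (2 * c' + 1) T D Bv C w) (hD : D + 2 ≤ 2 * c')
    (X : Finset (Finset (Fin n))) (hX : X ⊆ univ.powersetCard (2 * c' + 1)) (Y : Finset (PMatch n))
    (p : ℕ → Finset (Fin n) → ℝ) (hp : ∀ j, IsHarmonic j (p j))
    (hdec : ∀ U ∈ univ.powersetCard (2 * c' + 1),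
      (if U ∈ X then (1 : ℝ) else 0) = (∑ j ∈ range (2 * c' + 1 + 1), up^[2 * c' + 1 - j] (p j)) U)
    (hhead : ∀ κ ∈ Icc 1 (D / 2),
      |∑ M ∈ Y, ∑ U ∈ univ.powersetCard (2 * c' + 1),
          (up^[2 * c' + 1 - 2 * κ] (p (2 * κ))) U * (if (U.filter fun x => M.2.partner x ∉ U).card = 1 then (1 : ℝ) else 0)| /
          ((Fintype.card (PMatch n) : ℝ) * ((((n / 2).choose (1 + c') * (1 + c').choose c' * 2 ^ 1 : ℕ) : ℝ))) ≤
        4 * ((X.card : ℝ) / (n.choose (2 * c' + 1) : ℝ)) * ((Y.card : ℝ) / (Fintype.card (PMatch n) : ℝ)) * (1 / 16) ^ κ) :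
    ∑ U : OddSet n, ∑ M ∈ Y, levelWeight n (2 * c' + 1) C w U M * (if U.1 ∈ X then (1 : ℝ) else 0) ≤
      Bv * Real.sqrt ((∏ i ∈ range (D / 2 + 1), ((2 * i + 1 : ℝ) / ((n : ℝ) - 2 * i))) *
        ((X.card : ℝ) / (n.choose (2 * c' + 1) : ℝ)) * ((Y.card : ℝ) / (Fintype.card (PMatch n) : ℝ))) := by
  have ht : 2 * (2 * c' + 1) + 2 ≤ n := hdes.2.1
  have htrunc := rectangle_value_truncation_explicit hn hdes (by omega) X hX Y p hp hdec
  have hvirt := virtual_rectangle_ge hn (by omega) hD X hX Y p hp hdec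
  set μ : ℝ := (X.card : ℝ) / (n.choose (2 * c' + 1) : ℝ) with hμ
  set ν : ℝ := (Y.card : ℝ) / (Fintype.card (PMatch n) : ℝ) with hν
  have hμ0 : 0 ≤ μ := by positivity
  have hν0 : 0 ≤ ν := by positivity
  -- the head sum: `Σ_{κ} 2^κ · 4μν 16^{−κ} ≤ (4/7) μν`
  have hheadsum : ∑ κ ∈ Icc 1 (D / 2), (2 : ℝ) ^ κ *
      (|∑ M ∈ Y, ∑ U ∈ univ.powersetCard (2 * c' + 1),
          (up^[2 * c' + 1 - 2 * κ] (p (2 * κ))) U * (if (U.filter fun x => M.2.partner x ∉ U).card = 1 then (1 : ℝ) else 0)| /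
        ((Fintype.card (PMatch n) : ℝ) * ((((n / 2).choose (1 + c') * (1 + c').choose c' * 2 ^ 1 : ℕ) : ℝ)))) ≤
      4 * μ * ν * (1 / 7) := by
    calc _ ≤ ∑ κ ∈ Icc 1 (D / 2), (2 : ℝ) ^ κ * (4 * μ * ν * (1 / 16) ^ κ) :=
          sum_le_sum fun κ hκ => mul_le_mul_of_nonneg_left (hhead κ hκ) (by positivity)
      _ = 4 * μ * ν * ∑ κ ∈ Icc 1 (D / 2), ((1 : ℝ) / 8) ^ κ := by
          rw [mul_sum]
          refine sum_congr rfl fun κ _ => ?_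
          rw [show ((1 : ℝ) / 8) ^ κ = (2 : ℝ) ^ κ * (1 / 16) ^ κ by rw [← mul_pow]; norm_num]
          ring
      _ ≤ 4 * μ * ν * (1 / 7) := by
          refine mul_le_mul_of_nonneg_left ?_ (by positivity)
          have hsub : Icc 1 (D / 2) ⊆ Ico 1 (D / 2 + 1) := by
            intro κ hκ; rw [mem_Ico]; have := mem_Icc.1 hκ; omega
          calc ∑ κ ∈ Icc 1 (D / 2), ((1 : ℝ) / 8) ^ κ ≤ ∑ κ ∈ Ico 1 (D / 2 + 1), ((1 : ℝ) / 8) ^ κ :=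
                sum_le_sum_of_subset_of_nonneg hsub fun κ _ _ => by positivity
            _ ≤ ((1 : ℝ) / 8) ^ 1 / (1 - 1 / 8) := geom_sum_Ico_le_of_lt_one (by norm_num) (by norm_num)
            _ ≤ 1 / 7 := by norm_num
  have hvirt0 : 0 ≤ (Fintype.card (PMatch n) : ℝ)⁻¹ * ∑ M ∈ Y, ∑ A : {A : Finset (Fin n) // A.card ≤ D},
        (∑ j ∈ range (2 * c' + 1 + 1), ((2 * c' + 1 - j).factorial : ℝ) • (if D < j then 0 else p j)) A.1 *
          knapsackMoment M.1.card (((2 * c' + 1 : ℕ) : ℝ) / 2) (M.1.filter fun e => ∃ a ∈ A.1, a ∈ e).card := by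
    have : 0 ≤ μ * ν - 4 * μ * ν * (1 / 7) := by nlinarith [mul_nonneg hμ0 hν0]
    linarith
  have h1 := (abs_le.1 htrunc).2
  linarith

end Summit.PneNP.PneNP.Theorems.ChebyshevTracialDesignVirtualBimode
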